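import Literature.AlgebraicGeometry.Resolution.RegularLocalRingsQuotient
import Mathlib.RingTheory.DiscreteValuationRing.TFAE
import Mathlib.RingTheory.UniqueFactorizationDomain.Basic
import Mathlib.RingTheory.Nakayama
import Mathlib.RingTheory.PrincipalIdealDomain
import HarnessLib

/-!
# Two-dimensional regular local rings are factorial

Topic: `Literature/AlgebraicGeometry/Resolution`. Support file for the discharge of
`AbhyankarQuadraticFactorization` (`QuadraticTransforms.lean`; Abhyankar 1956, Thm. 3): the
special case `dim R = 2` of the Auslander–Buchsbaum theorem (Matsumura, Thm. 20.3: regular local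
rings are UFDs), PROVED here by an elementary argument special to dimension two, together with
the description of the prime ideals it yields.

## The argument

Let `(R, 𝔪)` be a regular local ring of dimension two and `x ∈ 𝔪 ∖ 𝔪²`. Then `R/(x)` is a
regular local ring of dimension one (Matsumura, Thm. 14.2, `IsRegularLocalRing.quotient_span_singleton`),
i.e. a discrete valuation ring, in particular a principal ideal ring
(`isPrincipalIdealRing_of_ringKrullDim_le_one`). Hence for a prime `𝔮 ∌ x` the image of `𝔮` in
`R/(x)` is generated by the class of one `f ∈ 𝔮`, so `𝔮 ⊆ fR + xR`, whence `𝔮 = fR + x𝔮`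
(`x ∉ 𝔮`, `𝔮` prime) and `𝔮 = fR` by Nakayama (`exists_eq_span_singleton_of_not_mem`); a prime
`𝔮 ∋ x` other than `𝔪` is `(x)` (`eq_span_singleton_of_mem`). So **every prime ideal other than
`𝔪` is principal** (`exists_eq_span_singleton_of_ne_maximalIdeal`), from which: an irreducible
`p` with `x ∤ p` lies in a prime `𝔮 ∌ x` (as `x ∉ √(p)`), `𝔮 = (f)`, `f ∣ p`, so `(p) = 𝔮` is
prime — **`R` is a unique factorisation domain** (`uniqueFactorizationMonoid_of_ringKrullDim_eq_two`);
and two relatively prime elements generate an `𝔪`-primary ideal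
(`exists_pow_maximalIdeal_le_span_pair`).

## Sources

* H. Matsumura, *Commutative Ring Theory*, CUP 1986, Thm. 14.2 (PDF p. 122), Thm. 20.3
  (PDF p. 179). [Matsumura1987]
* C. Huneke, I. Swanson, *Integral Closure of Ideals, Rings, and Modules*, CUP 2006, Ch. 14
  (two-dimensional regular local rings; "a two-dimensional regular local ring is a UFD" is used
  throughout, book p. 255).

NOT here: the general Auslander–Buchsbaum theorem (`Matsumura1987_20_3` stays a named fact).
-/

namespace Literature.AlgebraicGeometry.Resolution

universe u

open IsLocalRing

variable {R : Type u} [CommRing R]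

/-- A regular local ring of dimension `≤ 1` is a principal ideal ring (a field or a discrete
valuation ring): its maximal ideal needs `dim R ≤ 1` generators. [cite: Matsumura1987, Thm. 11.2 and §14] -/
theorem isPrincipalIdealRing_of_ringKrullDim_le_one [IsRegularLocalRing R]
    (h : ringKrullDim R ≤ 1) : IsPrincipalIdealRing R := by
  haveI := isDomain_of_isRegularLocalRing R
  refine ((tfae_of_isNoetherianRing_of_isLocalRing_of_isDomain R).out 0 5).mpr ?_
  rw [← spanFinrank_maximalIdeal_eq_finrank_cotangentSpace]
  have h1 := (isRegularLocalRing_iff R).mp ‹_›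
  rw [← h1] at h
  exact_mod_cast h

/-- `2 ≠ 0` in `WithBot ℕ∞` (bookkeeping). [folklore] -/
theorem ringKrullDim_ne_zero_of_eq_two (hdim : ringKrullDim R = 2) : ringKrullDim R ≠ 0 := by
  rw [hdim]; exact two_ne_zero

section DimTwo

variable [IsRegularLocalRing R]

/-- In a two-dimensional regular local ring, for `x ∈ 𝔪 ∖ 𝔪²` the ring `R/(x)` — a regular
local ring of dimension one — is a principal ideal ring. [cite: Matsumura1987, Thm. 14.2] -/
theorem isPrincipalIdealRing_quotient_of_not_mem_sq (hdim : ringKrullDim R = 2) {x : R}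
    (hx : x ∈ maximalIdeal R) (hx2 : x ∉ maximalIdeal R ^ 2) :
    IsPrincipalIdealRing (R ⧸ Ideal.span {x}) := by
  obtain ⟨hreg, hd⟩ := IsRegularLocalRing.quotient_span_singleton hx hx2
  apply isPrincipalIdealRing_of_ringKrullDim_le_one
  obtain ⟨n, hn⟩ := exists_nat_cast_eq_ringKrullDim (R := R ⧸ Ideal.span {x})
  rw [hdim, hn] at hd
  rw [hn]
  have h2 : n + 1 = 2 := by
    have : ((n + 1 : ℕ) : WithBot ℕ∞) = ((2 : ℕ) : WithBot ℕ∞) := by push_cast; exact hd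
    exact_mod_cast this
  have h1 : n = 1 := by omega
  subst h1
  exact le_rfl

/-- In a two-dimensional regular local ring with `x ∈ 𝔪 ∖ 𝔪²`, **a prime ideal not containing
`x` is principal**: its image in the principal ideal ring `R/(x)` is generated by the class of
some `f ∈ 𝔮`, so `𝔮 = fR + x𝔮`, and Nakayama gives `𝔮 = fR`.
[cite: Matsumura1987, Thm. 20.3 (dimension two)] -/
theorem exists_eq_span_singleton_of_not_mem (hdim : ringKrullDim R = 2) {x : R}
    (hx : x ∈ maximalIdeal R) (hx2 : x ∉ maximalIdeal R ^ 2) {q : Ideal R} [hq : q.IsPrime]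
    (hxq : x ∉ q) : ∃ f, q = Ideal.span {f} := by
  haveI := isPrincipalIdealRing_quotient_of_not_mem_sq hdim hx hx2
  set π := Ideal.Quotient.mk (Ideal.span {x}) with hπ
  have hsurj : Function.Surjective π := Ideal.Quotient.mk_surjective
  obtain ⟨g, hg⟩ := (IsPrincipalIdealRing.principal (q.map π)).principal
  have hgmem : g ∈ q.map π := by rw [hg]; exact Ideal.mem_span_singleton_self g
  obtain ⟨f, hfq, hfg⟩ := (Ideal.mem_map_iff_of_surjective π hsurj).mp hgmem
  refine ⟨f, le_antisymm ?_ ((Ideal.span_singleton_le_iff_mem _).mpr hfq)⟩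
  have key : q ≤ Ideal.span {f} ⊔ maximalIdeal R • q := by
    intro g' hg'
    have hmem : π g' ∈ q.map π := Ideal.mem_map_of_mem π hg'
    rw [hg] at hmem
    obtain ⟨c, hc⟩ := Ideal.mem_span_singleton'.mp hmem
    obtain ⟨c', rfl⟩ := hsurj c
    have hsub : g' - c' * f ∈ Ideal.span {x} := by
      rw [← Ideal.Quotient.eq, map_mul, hfg]
      exact hc.symm
    obtain ⟨r, hr⟩ := Ideal.mem_span_singleton'.mp hsub
    have hrq : r ∈ q := by
      have : r * x ∈ q := by
        rw [hr]; exact q.sub_mem hg' (q.mul_mem_left _ hfq)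
      exact (hq.mem_or_mem this).resolve_right hxq
    have e : g' = c' * f + x • r := by
      rw [smul_eq_mul, mul_comm x r, hr]; ring
    rw [e]
    exact Submodule.add_mem_sup (Ideal.mem_span_singleton'.mpr ⟨c', rfl⟩)
      (Submodule.smul_mem_smul hx hrq)
  exact Submodule.le_of_le_smul_of_le_jacobson_bot (IsNoetherian.noetherian q)
    (maximalIdeal_le_jacobson _) key

/-- In a two-dimensional regular local ring with `x ∈ 𝔪 ∖ 𝔪²`, **a prime ideal containing `x`
other than `𝔪` is `(x)`**: its image in the one-dimensional domain `R/(x)` is a prime, hence zero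
or maximal. [cite: Matsumura1987, Thm. 14.2] -/
theorem eq_span_singleton_of_mem (hdim : ringKrullDim R = 2) {x : R}
    (hx : x ∈ maximalIdeal R) (hx2 : x ∉ maximalIdeal R ^ 2) {q : Ideal R} [hq : q.IsPrime]
    (hxq : x ∈ q) (hqm : q ≠ maximalIdeal R) : q = Ideal.span {x} := by
  haveI := isPrincipalIdealRing_quotient_of_not_mem_sq hdim hx hx2
  have hxp : Prime x := IsRegularLocalRing.prime_of_not_mem_sq hx hx2
  haveI : IsDomain (R ⧸ Ideal.span {x}) :=
    (Ideal.Quotient.isDomain_iff_prime _).mpr ((Ideal.span_singleton_prime hxp.ne_zero).mpr hxp)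
  set π := Ideal.Quotient.mk (Ideal.span {x}) with hπ
  have hsurj : Function.Surjective π := Ideal.Quotient.mk_surjective
  have hle : Ideal.span {x} ≤ q := (Ideal.span_singleton_le_iff_mem _).mpr hxq
  have hker : RingHom.ker π ≤ q := by rw [Ideal.mk_ker]; exact hle
  haveI hprime : (q.map π).IsPrime := Ideal.map_isPrime_of_surjective hsurj hker
  by_cases hbot : q.map π = ⊥
  · refine le_antisymm ?_ hle
    intro g hg
    have := Ideal.mem_map_of_mem π hg
    rw [hbot, Ideal.mem_bot, Ideal.Quotient.eq_zero_iff_mem] at this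
    exact this
  · exfalso
    apply hqm
    have hmax : (q.map π).IsMaximal := IsPrime.to_maximal_ideal hbot
    have hcm : (Ideal.comap π (q.map π)).IsMaximal := Ideal.comap_isMaximal_of_surjective π hsurj
    have e : Ideal.comap π (q.map π) = q := by
      rw [Ideal.comap_map_of_surjective π hsurj, ← RingHom.ker_eq_comap_bot]
      exact sup_eq_left.mpr hker
    rw [e] at hcm
    exact IsLocalRing.eq_maximalIdeal hcm

/-- In a two-dimensional regular local ring **every prime ideal other than the maximal ideal is
principal** (the height-one primes of a two-dimensional UFD).
[cite: Matsumura1987, Thm. 20.3 (dimension two)] -/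
theorem exists_eq_span_singleton_of_ne_maximalIdeal (hdim : ringKrullDim R = 2) (q : Ideal R)
    [q.IsPrime] (hqm : q ≠ maximalIdeal R) : ∃ f, q = Ideal.span {f} := by
  obtain ⟨x, hx, hx2⟩ :=
    IsRegularLocalRing.exists_not_mem_sq (R := R) (ringKrullDim_ne_zero_of_eq_two hdim)
  by_cases hxq : x ∈ q
  · exact ⟨x, eq_span_singleton_of_mem hdim hx hx2 hxq hqm⟩
  · exact exists_eq_span_singleton_of_not_mem hdim hx hx2 hxq

/-- **A two-dimensional regular local ring is a unique factorisation domain** (the case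
`dim R = 2` of Auslander–Buchsbaum, Matsumura Thm. 20.3), by the elementary argument of this
file: an irreducible `p` not divisible by the prime element `x ∈ 𝔪 ∖ 𝔪²` lies in a prime ideal
`𝔮 ∌ x`, which is principal, `𝔮 = (f)`; then `f ∣ p` forces `(p) = 𝔮`, so `p` is prime.
[cite: Matsumura1987, Thm. 20.3 (dimension two)] -/
theorem uniqueFactorizationMonoid_of_ringKrullDim_eq_two (hdim : ringKrullDim R = 2) :
    UniqueFactorizationMonoid R := by
  haveI := isDomain_of_isRegularLocalRing R
  obtain ⟨x, hx, hx2⟩ :=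
    IsRegularLocalRing.exists_not_mem_sq (R := R) (ringKrullDim_ne_zero_of_eq_two hdim)
  have hxp : Prime x := IsRegularLocalRing.prime_of_not_mem_sq hx hx2
  refine { irreducible_iff_prime := fun {p} => ⟨fun hp => ?_, Prime.irreducible⟩ }
  by_cases hxdvd : x ∣ p
  · obtain ⟨c, rfl⟩ := hxdvd
    have hc : IsUnit c := (hp.isUnit_or_isUnit rfl).resolve_left hxp.not_unit
    exact (associated_mul_unit_left x c hc).symm.prime hxp
  · -- `x ∉ √(p)`: a divisor of `xⁿ` is an associate of a power of the prime `x`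
    have hrad : x ∉ (Ideal.span {p}).radical := by
      rintro ⟨n, hn⟩
      rw [Ideal.mem_span_singleton] at hn
      obtain ⟨i, -, hassoc⟩ := (dvd_prime_pow hxp n).mp hn
      rcases Nat.eq_zero_or_pos i with rfl | hi
      · rw [pow_zero] at hassoc
        exact hp.not_isUnit (associated_one_iff_isUnit.mp hassoc)
      · exact hxdvd ((dvd_pow_self x hi.ne').trans hassoc.symm.dvd)
    rw [Ideal.radical_eq_sInf, Submodule.mem_sInf] at hrad
    push Not at hrad
    obtain ⟨Q, ⟨hpQ, hQ⟩, hxQ⟩ := hrad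
    haveI := hQ
    obtain ⟨f, rfl⟩ := exists_eq_span_singleton_of_not_mem hdim hx hx2 hxQ
    have hfp : f ∣ p := Ideal.mem_span_singleton.mp (hpQ (Ideal.mem_span_singleton_self p))
    obtain ⟨c, hc⟩ := hfp
    have hf : ¬ IsUnit f := fun hf =>
      hQ.ne_top (Ideal.span_singleton_eq_top.mpr hf)
    have hc' : IsUnit c := (hp.isUnit_or_isUnit hc).resolve_left hf
    have hassoc : Associated f p := ⟨hc'.unit, by rw [IsUnit.unit_spec, hc]⟩
    have e : Ideal.span {p} = Ideal.span {f} :=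
      Ideal.span_singleton_eq_span_singleton.mpr hassoc.symm
    rw [← Ideal.span_singleton_prime hp.ne_zero, e]
    exact hQ

/-- In a two-dimensional regular local ring **two relatively prime elements generate an
`𝔪`-primary ideal**: `𝔪ᴺ ⊆ (a, b)` for some `N` — every prime over `(a, b)` other than `𝔪`
would be principal, generated by a common divisor of `a` and `b`.
[cite: Matsumura1987, Thm. 20.3 (dimension two)] -/
theorem exists_pow_maximalIdeal_le_span_pair (hdim : ringKrullDim R = 2) {a b : R}
    (hab : IsRelPrime a b) : ∃ N : ℕ, maximalIdeal R ^ N ≤ Ideal.span {a, b} := by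
  apply Ideal.exists_pow_le_of_le_radical_of_fg _ (IsNoetherian.noetherian _)
  rw [Ideal.radical_eq_sInf]
  refine le_sInf ?_
  rintro J ⟨hJ, hJp⟩
  haveI := hJp
  by_cases hJm : J = maximalIdeal R
  · exact hJm ▸ le_rfl
  · exfalso
    obtain ⟨f, rfl⟩ := exists_eq_span_singleton_of_ne_maximalIdeal hdim J hJm
    have ha : f ∣ a := Ideal.mem_span_singleton.mp (hJ (Ideal.subset_span (by simp)))
    have hb : f ∣ b := Ideal.mem_span_singleton.mp (hJ (Ideal.subset_span (by simp)))
    exact hJp.ne_top (Ideal.span_singleton_eq_top.mpr (hab ha hb))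

end DimTwo

end Literature.AlgebraicGeometry.Resolution
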